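import Literature.NumberTheory.ComplexMultiplication.CMLatticeRingClassTowerTwoTameOverLevel
import Literature.NumberTheory.ComplexMultiplication.CMLatticeRingClassTowerTameWild
import HarnessLib

/-!
# `p = 2` over ANY tame level `K[f]`, `f ≥ 2`, and every prime over every level: the complete answer
# `ker(I_K(2^n f)/P_{K,ℤ}(2^n f) → I_K(f)/P_{K,ℤ}(f))` is cyclic at every level iff
# `4 ∣ f`, or `2 ∥ f` and `d_K` is even, or `f` is odd and `d_K ≡ 8 (mod 16)`

Family `hodge`, lane `lit-hodgefound` (Track 2 foundations library; Layer A3 at `g = 1`, the «arbitrary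
order» series), topic `Literature/NumberTheory/ComplexMultiplication`, namespace
`Literature.NumberTheory.ComplexMultiplication.CMTypeLattice` — the `p = 2` counterpart of
`CMLatticeRingClassTowerTameWild` §4 (odd `p` over any `f ≥ 2`), assembling `CMLatticeRingClassTowerTwoTame`
(`2 ∥ f`: over `2f₀` with `f₀` odd), `CMLatticeRingClassTowerTameWild` §3 (`4 ∣ f`) and
`CMLatticeRingClassTowerTwoTameOverLevel` (`f` odd). THEOREMS ONLY: no definition, no named fact (D-0026; net
Literature debt 0).

## Sources, VERBATIM

* K. Martin, *Rationality fields of CM modular forms* [Martin2025RationalityFieldsCM], §8 «Structure of dyadic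
  modular quotients» (held `paper:arxiv-2509.24119`, chunk 14) = A. Ranum [Ranum1910] Types 5–9: «`(𝔬_E/𝔭^n)^× ≃
  (ℤ/2^nℤ)^× ≃ C_2 × C_{2^{n−2}}`» (split), «`C_3 × ⟨−1⟩ × C_{2^{n−1}} × C_{2^{n−2}}` […] `5` generates a subgroup of
  index `2` of the third factor» (inert), «`4 ∥ Δ_E` […] `G ≃ C_2 × C_{2^a} × C_{2^b}`», «`8 ∥ Δ_E` […] `1 + √d`
  generates the `C_{2^s}` factor».
* J.-P. Serre, *A Course in Arithmetic* [Serre1973], Ch. II §3.2 Prop. 8, p. 17: «If `p = 2`, `U_1 = {±1} × U_2`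
  and `U_2` is isomorphic to `ℤ_2`» — over a level divisible by `4` only `U_2`-quotients occur (cyclic); over
  `2f₀` resp. odd `f` the `{±1}` resp. `√(d_K/4)` torsion decides.
* J. Neukirch, *Algebraic Number Theory* [NeukirchANT1999], Ch. II (5.7), p. 140 (torsion of `U^{(1)}`).
* D. A. Cox, *Primes of the Form x² + ny²* [Cox2013], §7.D Thm. 7.24, (7.27), Cor. 7.28, pp. 146–148.
* B. H. Gross, *Kolyvagin's work on modular elliptic curves* [GrossLMS1991], §3 (PDF p. 216–217): the ring class
  tower `K[f] ⊂ K[ℓf] ⊂ K[ℓ²f] ⊂ ⋯`.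

## What is formalised (theorems only)

`K` imaginary quadratic (`[IsCMField K]`, `finrank ℚ K = 2`), `f ≥ 2`, `d = d_K`.
* §2 `2 ∣ f` (level transport `2^n·(2f₀) = 2^{n+1}·f₀` done inline by `subst`): `isCyclic_ker_restrict_dvd_two_pow_mul_of_two_dvd` (`4 ∣ f` or `d_K` even: cyclic at every
  level), `not_isCyclic_ker_restrict_dvd_two_pow_mul_of_two_dvd` (`2 ∥ f`, `d_K` odd, `n ≥ 2`: not cyclic),
  `isCyclic_ker_restrict_dvd_two_mul_of_two_le` (level `2f` over `f`: cyclic for every `f ≥ 2`).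
* §3 THE CLASSIFICATION AT `p = 2` OVER `K[f]`, `f ≥ 2`: **`isCyclic_ker_restrict_dvd_two_pow_mul_iff_of_two_le`**
  (`n ≥ 3`: cyclic iff `4 ∣ f ∨ (2 ∣ f ∧ d even) ∨ (2 ∤ f ∧ d ≡ 8 (16))`),
  **`isCyclic_ker_restrict_dvd_four_mul_iff_of_two_le`** (`n = 2`: cyclic iff `4 ∣ f ∨ (2 ∣ f ∧ d even) ∨
  (2 ∤ f ∧ d ≢ 12 (16))`), **`forall_isCyclic_ker_restrict_dvd_two_pow_mul_iff_of_two_le`** (all levels).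
* §4 EVERY PRIME OVER EVERY LEVEL `f ≥ 2`: **`not_isCyclic_ker_restrict_dvd_prime_pow_mul_iff_of_prime`** (`n ≥ 3`)
  and **`forall_isCyclic_ker_restrict_dvd_prime_pow_mul_iff_of_prime`**: the ring class `p`-tower over `K[f]` is
  cyclic at every level iff NOT [`p = 3 ∧ 3 ∤ f ∧ d ≡ 6 (9)`] and NOT [`p = 2 ∧ 4 ∤ f ∧ ¬(2 ∣ f ∧ d even) ∧
  ¬(2 ∤ f ∧ d ≡ 8 (16))`] (over `Cl(𝒪_K)`, `f = 1`, see `CMLatticeRingClassTowerTwoClassification`).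

## References
* [Martin2025RationalityFieldsCM] K. Martin, arXiv:2509.24119 (2025), §8.
  [cite: Martin2025RationalityFieldsCM, §8 (Structure of dyadic modular quotients)]
* [Ranum1910] A. Ranum, Trans. AMS 11 (1910) 172–198. [cite: Ranum1910, Types 5–9 (via Martin2025RationalityFieldsCM §8)]
* [Serre1973] J.-P. Serre, *A Course in Arithmetic*, Ch. II §3.2 Prop. 8, p. 17. [cite: Serre1973, Ch. II §3.2 Prop. 8, p. 17]
* [NeukirchANT1999] J. Neukirch, *Algebraic Number Theory*, Ch. II (5.7), p. 140. [cite: NeukirchANT1999, Ch. II (5.7) Proposition, p. 140]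
* [Cox2013] D. A. Cox, *Primes of the Form x² + ny²*, 2nd ed., §7.D Thm. 7.24, Cor. 7.28, pp. 146–148.
  [cite: Cox2013, §7.D Cor. 7.28, p. 148]
* [GrossLMS1991] B. H. Gross, LMS LNS 153 (1991), §3. [cite: GrossLMS1991, §3 (PDF p. 216–217)]

## Mathlib / tree search
Tree, BY NAME: `isCyclic_ker_restrict_two_mul_dvd_two_pow_mul`, `not_isCyclic_ker_restrict_two_mul_dvd_two_pow_mul_of_odd`
(`…TowerTwoTame`), `isCyclic_ker_restrict_dvd_two_pow_mul_of_four_dvd`, `isCyclic_ker_restrict_dvd_prime_pow_mul_of_prime_dvd`,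
`not_isCyclic_ker_restrict_dvd_prime_pow_mul_iff_of_two_le` (`…TowerTameWild`),
`isCyclic_ker_restrict_dvd_prime_pow_mul_of_odd` (`…TowerTameClassification`), `natCard_ker_restrict_prime_mul`,
`isCyclic_ker_restrict_prime_mul` (`…TowerDegrees`), `isCyclic_ker_restrict_dvd_two_pow_mul_of_discr_emod_sixteen_eq_eight`,
`not_isCyclic_ker_restrict_dvd_two_pow_mul_of_discr_emod_sixteen_eq_twelve`, `not_isCyclic_ker_restrict_dvd_two_pow_mul_of_odd`,
`isCyclic_ker_restrict_dvd_four_mul_of_odd`, `isCyclic_ker_restrict_dvd_two_mul`, `isCyclic_ker_restrict_dvd_two_pow_mul_iff`,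
`isCyclic_ker_restrict_dvd_four_mul_iff` (`…TowerTwoTameOverLevel`), `discr_emod_sixteen_of_even` (`…TwoOverClassGroup`).
grep «of_two_le|TwoTameClassification» in the tree: only the odd-`p` statements of `…TameWild`.
-/

open scoped NumberField nonZeroDivisors
open NumberField Module

namespace Literature.NumberTheory.ComplexMultiplication

open Literature.NumberTheory.QuadraticFields Literature.NumberTheory.QuadraticFields.RingClass
open Literature.NumberTheory.QuadraticFields.Quadratic
open Literature.NumberTheory.EllipticCurves (IsImaginaryQuadratic isImaginaryQuadratic_iff_isCMField)

namespace CMTypeLattice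

variable {K : Type} [Field K] [NumberField K] [IsCMField K] (h2 : finrank ℚ K = 2) {f : ℕ}

/-! ## §2. Even tame levels -/

include h2 in
/-- **`2 ∣ f`, and `4 ∣ f` or `d_K` even: `ker(I_K(2^n f)/P_{K,ℤ}(2^n f) → I_K(f)/P_{K,ℤ}(f))` IS CYCLIC for every
`n`** — for `4 ∣ f` this is `CMLatticeRingClassTowerTameWild` §3 (Serre's `U_2 ≅ ℤ_2`); for `f = 2f₀`, `f₀` odd,
`d_K` even it is `ker(I_K(2^{n+1} f₀) → I_K(2f₀))`, cyclic generated by `[(1 + 2f₀ω)𝒪_K]`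
(`CMLatticeRingClassTowerTwoTame`). [cite: Serre1973, Ch. II §3.2 Prop. 8, p. 17] [cite: Cox2013, §7.D Cor. 7.28, p. 148]
[cite: GrossLMS1991, §3 (PDF p. 216)] -/
theorem isCyclic_ker_restrict_dvd_two_pow_mul_of_two_dvd (h : Even (NumberField.discr K) ∨ 4 ∣ f) (hf : f ≠ 0)
    (h2f : 2 ∣ f) {n : ℕ} (hfN : f ∣ 2 ^ n * f) : IsCyclic (restrict (K := K) hfN).ker := by
  by_cases h4f : 4 ∣ f
  · exact isCyclic_ker_restrict_dvd_two_pow_mul_of_four_dvd h2 hf h4f hfN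
  · have heven : Even (NumberField.discr K) := h.resolve_right h4f
    obtain ⟨f₀, rfl⟩ := h2f
    have hf₀ : f₀ ≠ 0 := by rintro rfl; exact hf rfl
    have hN : 2 ^ n * (2 * f₀) = 2 ^ (n + 1) * f₀ := by ring
    have hmn' : 2 * f₀ ∣ 2 ^ (n + 1) * f₀ := mul_dvd_mul_right (dvd_pow_self 2 (by omega)) f₀
    -- transport along the equal levels `2^n·(2f₀) = 2^{n+1}·f₀` (indices of `RingClassGroup K ·`)
    have key : ∀ {N : ℕ} (_ : N = 2 ^ (n + 1) * f₀) (h : 2 * f₀ ∣ N),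
        IsCyclic (restrict (K := K) h).ker ↔ IsCyclic (restrict (K := K) hmn').ker := by
      intro N hN' h; subst hN'; exact Iff.rfl
    rw [key hN hfN]
    exact isCyclic_ker_restrict_two_mul_dvd_two_pow_mul h2 (Or.inl heven) hf₀ (by omega) hmn'

include h2 in
/-- **`2 ∥ f`, `d_K` odd, `n ≥ 2`: `ker(I_K(2^n f)/P_{K,ℤ}(2^n f) → I_K(f)/P_{K,ℤ}(f))` IS NOT CYCLIC** — with
`f = 2f₀`, `f₀` odd, it is `ker(I_K(2^{n+1} f₀) → I_K(2f₀))`, which contains the Klein four-group of level `8f₀`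
(`CMLatticeRingClassTowerTwoTame`; Martin/Ranum: `C_2 × C_{2^{n−2}}` for `2` unramified; Serre: `U_1 = {±1} × U_2`).
[cite: Martin2025RationalityFieldsCM, §8 (Structure of dyadic modular quotients)] [cite: Serre1973, Ch. II §3.2 Prop. 8, p. 17] -/
theorem not_isCyclic_ker_restrict_dvd_two_pow_mul_of_two_dvd (hodd : Odd (NumberField.discr K)) (h2f : 2 ∣ f)
    (h4f : ¬ 4 ∣ f) {n : ℕ} (hn : 2 ≤ n) (hfN : f ∣ 2 ^ n * f) : ¬ IsCyclic (restrict (K := K) hfN).ker := by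
  obtain ⟨f₀, rfl⟩ := h2f
  have hodd₀ : Odd f₀ := by
    refine Nat.odd_iff.2 (by_contra fun h => h4f ?_)
    have : 2 ∣ f₀ := Nat.dvd_of_mod_eq_zero (by omega)
    obtain ⟨c, rfl⟩ := this
    exact ⟨c, by ring⟩
  have hN : 2 ^ n * (2 * f₀) = 2 ^ (n + 1) * f₀ := by ring
  have hmn' : 2 * f₀ ∣ 2 ^ (n + 1) * f₀ := mul_dvd_mul_right (dvd_pow_self 2 (by omega)) f₀
  have key : ∀ {N : ℕ} (_ : N = 2 ^ (n + 1) * f₀) (h : 2 * f₀ ∣ N),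
      IsCyclic (restrict (K := K) h).ker ↔ IsCyclic (restrict (K := K) hmn').ker := by
    intro N hN' h; subst hN'; exact Iff.rfl
  rw [key hN hfN]
  exact not_isCyclic_ker_restrict_two_mul_dvd_two_pow_mul_of_odd h2 hodd hodd₀ (by omega) hmn'

include h2 in
/-- **Level `2f` over `f` is cyclic for every `f ≥ 2`**: of order `2` for `2 ∣ f` (`h(𝒪_{2f}) = 2h(𝒪_f)`,
COR. 7.28), of order `2 − (d_K/2) ∈ {1, 2, 3}` for `f` odd. [cite: Cox2013, §7.D Cor. 7.28, p. 148]
[cite: GrossLMS1991, §3 (PDF p. 217, G_ℓ ≃ F_λ^×/F_ℓ^×)] -/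
theorem isCyclic_ker_restrict_dvd_two_mul_of_two_le (hf2 : 2 ≤ f) (hfN : f ∣ 2 ^ 1 * f) :
    IsCyclic (restrict (K := K) hfN).ker := by
  have hN : 2 ^ 1 * f = 2 * f := by rw [pow_one]
  have key : ∀ {N : ℕ} (_ : N = 2 * f) (h : f ∣ N),
      IsCyclic (restrict (K := K) h).ker ↔ IsCyclic (restrict (K := K) (dvd_mul_left f 2)).ker := by
    intro N hN' h; subst hN'; exact Iff.rfl
  rw [key hN hfN]
  by_cases h2f : 2 ∣ f
  · exact isCyclic_ker_restrict_prime_mul h2 Nat.prime_two (by omega) h2f (dvd_mul_left f 2)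
  · exact isCyclic_ker_restrict_dvd_two_mul h2 hf2 (Nat.odd_iff.2 (by omega)) (dvd_mul_left f 2)

/-! ## §3. The classification at `p = 2` over `K[f]`, `f ≥ 2` -/

include h2 in
/-- **`p = 2` OVER `K[f]`, `f ≥ 2`, `n ≥ 3`: `ker(I_K(2^n f)/P_{K,ℤ}(2^n f) → I_K(f)/P_{K,ℤ}(f))` is cyclic IFF
`4 ∣ f`, or `2 ∣ f` and `d_K` is even, or `f` is odd and `d_K ≡ 8 (mod 16)`.** [cite: Martin2025RationalityFieldsCM, §8 (Structure of dyadic modular quotients)]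
[cite: Serre1973, Ch. II §3.2 Prop. 8, p. 17] [cite: NeukirchANT1999, Ch. II (5.7) Proposition, p. 140]
[cite: Cox2013, §7.D Cor. 7.28, p. 148] -/
theorem isCyclic_ker_restrict_dvd_two_pow_mul_iff_of_two_le (hf2 : 2 ≤ f) {n : ℕ} (hn : 3 ≤ n)
    (hfN : f ∣ 2 ^ n * f) :
    IsCyclic (restrict (K := K) hfN).ker ↔
      4 ∣ f ∨ (2 ∣ f ∧ Even (NumberField.discr K)) ∨ (¬ 2 ∣ f ∧ NumberField.discr K % 16 = 8) := by
  by_cases h2f : 2 ∣ f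
  · by_cases h4f : 4 ∣ f
    · exact ⟨fun _ => Or.inl h4f, fun _ => isCyclic_ker_restrict_dvd_two_pow_mul_of_two_dvd h2 (Or.inr h4f)
        (by omega) h2f hfN⟩
    · rcases Int.even_or_odd (NumberField.discr K) with heven | hodd
      · exact ⟨fun _ => Or.inr (Or.inl ⟨h2f, heven⟩), fun _ =>
          isCyclic_ker_restrict_dvd_two_pow_mul_of_two_dvd h2 (Or.inl heven) (by omega) h2f hfN⟩
      · refine ⟨fun hc => ?_, fun h => ?_⟩
        · exact absurd hc (not_isCyclic_ker_restrict_dvd_two_pow_mul_of_two_dvd h2 hodd h2f h4f (by omega) hfN)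
        · rcases h with h | ⟨-, h⟩ | ⟨h, -⟩
          · exact absurd h h4f
          · exact absurd h (Int.not_even_iff_odd.2 hodd)
          · exact absurd h2f h
  · have hfo : Odd f := Nat.odd_iff.2 (by omega)
    rw [isCyclic_ker_restrict_dvd_two_pow_mul_iff h2 hf2 hfo hn hfN]
    constructor
    · exact fun h8 => Or.inr (Or.inr ⟨h2f, h8⟩)
    · rintro (h | ⟨h, -⟩ | ⟨-, h⟩)
      · exact absurd (dvd_trans (by norm_num) h) h2f
      · exact absurd h h2f
      · exact h

include h2 in
/-- **Level `4f` over `K[f]`, `f ≥ 2`: cyclic iff `4 ∣ f`, or `2 ∣ f` and `d_K` even, or `f` odd and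
`d_K ≢ 12 (mod 16)`.** [cite: Martin2025RationalityFieldsCM, §8 (Structure of dyadic modular quotients)]
[cite: Cox2013, §7.D Cor. 7.28, p. 148] -/
theorem isCyclic_ker_restrict_dvd_four_mul_iff_of_two_le (hf2 : 2 ≤ f) (hfN : f ∣ 2 ^ 2 * f) :
    IsCyclic (restrict (K := K) hfN).ker ↔
      4 ∣ f ∨ (2 ∣ f ∧ Even (NumberField.discr K)) ∨ (¬ 2 ∣ f ∧ NumberField.discr K % 16 ≠ 12) := by
  by_cases h2f : 2 ∣ f
  · by_cases h4f : 4 ∣ f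
    · exact ⟨fun _ => Or.inl h4f, fun _ => isCyclic_ker_restrict_dvd_two_pow_mul_of_two_dvd h2 (Or.inr h4f)
        (by omega) h2f hfN⟩
    · rcases Int.even_or_odd (NumberField.discr K) with heven | hodd
      · exact ⟨fun _ => Or.inr (Or.inl ⟨h2f, heven⟩), fun _ =>
          isCyclic_ker_restrict_dvd_two_pow_mul_of_two_dvd h2 (Or.inl heven) (by omega) h2f hfN⟩
      · refine ⟨fun hc => ?_, fun h => ?_⟩
        · exact absurd hc (not_isCyclic_ker_restrict_dvd_two_pow_mul_of_two_dvd h2 hodd h2f h4f le_rfl hfN)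
        · rcases h with h | ⟨-, h⟩ | ⟨h, -⟩
          · exact absurd h h4f
          · exact absurd h (Int.not_even_iff_odd.2 hodd)
          · exact absurd h2f h
  · have hfo : Odd f := Nat.odd_iff.2 (by omega)
    rw [isCyclic_ker_restrict_dvd_four_mul_iff h2 hf2 hfo hfN]
    constructor
    · exact fun h12 => Or.inr (Or.inr ⟨h2f, h12⟩)
    · rintro (h | ⟨h, -⟩ | ⟨-, h⟩)
      · exact absurd (dvd_trans (by norm_num) h) h2f
      · exact absurd h h2f
      · exact h

include h2 in
/-- **THE `2`-POWER RING CLASS TOWER OVER `K[f]`, `f ≥ 2`, IS CYCLIC AT EVERY LEVEL IFF `4 ∣ f`, OR `2 ∥ f` AND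
`d_K` IS EVEN, OR `f` IS ODD AND `d_K ≡ 8 (mod 16)`** (`K` imaginary quadratic; the ideal-theoretic
`Gal(K[2^n f]/K[f])`, `n ≥ 1`). [cite: Martin2025RationalityFieldsCM, §8 (Structure of dyadic modular quotients)]
[cite: Serre1973, Ch. II §3.2 Prop. 8, p. 17] [cite: NeukirchANT1999, Ch. II (5.7) Proposition, p. 140]
[cite: Cox2013, §7.D Thm. 7.24 and Cor. 7.28, pp. 146–148] -/
theorem forall_isCyclic_ker_restrict_dvd_two_pow_mul_iff_of_two_le (hf2 : 2 ≤ f) :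
    (∀ n : ℕ, 1 ≤ n → IsCyclic (restrict (K := K) (dvd_mul_left f (2 ^ n))).ker) ↔
      4 ∣ f ∨ (2 ∣ f ∧ Even (NumberField.discr K)) ∨ (¬ 2 ∣ f ∧ NumberField.discr K % 16 = 8) := by
  constructor
  · intro h
    exact (isCyclic_ker_restrict_dvd_two_pow_mul_iff_of_two_le h2 hf2 (le_refl 3) (dvd_mul_left f (2 ^ 3))).1
      (h 3 (by norm_num))
  · intro h n hn
    rcases h with h4f | ⟨h2f, heven⟩ | ⟨h2f, h8⟩
    · exact isCyclic_ker_restrict_dvd_two_pow_mul_of_two_dvd h2 (Or.inr h4f) (by omega)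
        (dvd_trans (by norm_num) h4f) _
    · exact isCyclic_ker_restrict_dvd_two_pow_mul_of_two_dvd h2 (Or.inl heven) (by omega) h2f _
    · exact isCyclic_ker_restrict_dvd_two_pow_mul_of_discr_emod_sixteen_eq_eight h2 h8 hf2
        (Nat.odd_iff.2 (by omega)) hn _

/-! ## §4. Every prime over every level `f ≥ 2` -/

include h2 in
/-- **EVERY PRIME `p` OVER EVERY LEVEL `f ≥ 2`, `n ≥ 3`: `ker(I_K(p^n f)/P_{K,ℤ}(p^n f) → I_K(f)/P_{K,ℤ}(f))` is NOT
cyclic iff [`p = 3`, `3 ∤ f`, `d_K ≡ 6 (mod 9)`] or [`p = 2`, `4 ∤ f`, not (`2 ∣ f` and `d_K` even), not (`f` odd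
and `d_K ≡ 8 (mod 16)`)]** (odd `p`: `CMLatticeRingClassTowerTameWild` §4). [cite: Serre1973, Ch. II §3.2 Prop. 8, p. 17]
[cite: Martin2025RationalityFieldsCM, §8 (Structure of dyadic modular quotients)] [cite: Cox2013, §7.D Cor. 7.28, p. 148] -/
theorem not_isCyclic_ker_restrict_dvd_prime_pow_mul_iff_of_prime {p : ℕ} (hp : p.Prime) (hf2 : 2 ≤ f)
    {n : ℕ} (hn : 3 ≤ n) (hfN : f ∣ p ^ n * f) :
    ¬ IsCyclic (restrict (K := K) hfN).ker ↔
      (p = 3 ∧ ¬ 3 ∣ f ∧ NumberField.discr K % 9 = 6) ∨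
        (p = 2 ∧ ¬ 4 ∣ f ∧ ¬ (2 ∣ f ∧ Even (NumberField.discr K)) ∧
          ¬ (¬ 2 ∣ f ∧ NumberField.discr K % 16 = 8)) := by
  by_cases hp2 : p = 2
  · subst hp2
    rw [isCyclic_ker_restrict_dvd_two_pow_mul_iff_of_two_le h2 hf2 hn hfN]
    constructor
    · intro h
      exact Or.inr ⟨rfl, fun h4 => h (Or.inl h4), fun he => h (Or.inr (Or.inl he)), fun ho => h (Or.inr (Or.inr ho))⟩
    · rintro (⟨h23, -⟩ | ⟨-, h4, he, ho⟩)
      · omega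
      · rintro (h | h | h)
        · exact h4 h
        · exact he h
        · exact ho h
  · rw [not_isCyclic_ker_restrict_dvd_prime_pow_mul_iff_of_two_le h2 hp hp2 hf2 (by omega) hfN]
    constructor
    · exact fun h => Or.inl h
    · rintro (h | ⟨h, -⟩)
      · exact h
      · exact absurd h hp2

include h2 in
/-- **THE RING CLASS `p`-TOWER OVER `K[f]`, `f ≥ 2`, IS CYCLIC AT EVERY LEVEL IFF NOT [`p = 3 ∧ 3 ∤ f ∧ d_K ≡ 6 (9)`]
AND NOT [`p = 2 ∧ 4 ∤ f ∧ ¬(2 ∣ f ∧ d_K even) ∧ ¬(2 ∤ f ∧ d_K ≡ 8 (16))`]** — for `K` imaginary quadratic, every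
prime `p`, every `f ≥ 2`; the ideal-theoretic `Gal(K[p^n f]/K[f])`, `n ≥ 1` (over `Cl(𝒪_K)`, `f = 1`:
`CMLatticeRingClassTowerTwoClassification.forall_isCyclic_ker_toClassGroup_prime_pow_iff`).
[cite: Serre1973, Ch. II §3.1 Prop. 7 and §3.2 Prop. 8, pp. 16–17] [cite: Martin2025RationalityFieldsCM, §8 (Structure of dyadic modular quotients)]
[cite: NeukirchANT1999, Ch. II (5.7) Proposition, p. 140] [cite: Cox2013, §7.D Thm. 7.24 and Cor. 7.28, pp. 146–148]
[cite: GrossLMS1991, §3 (PDF p. 216–217)] -/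
theorem forall_isCyclic_ker_restrict_dvd_prime_pow_mul_iff_of_prime {p : ℕ} (hp : p.Prime) (hf2 : 2 ≤ f) :
    (∀ n : ℕ, 1 ≤ n → IsCyclic (restrict (K := K) (dvd_mul_left f (p ^ n))).ker) ↔
      ¬ (p = 3 ∧ ¬ 3 ∣ f ∧ NumberField.discr K % 9 = 6) ∧
        ¬ (p = 2 ∧ ¬ 4 ∣ f ∧ ¬ (2 ∣ f ∧ Even (NumberField.discr K)) ∧
          ¬ (¬ 2 ∣ f ∧ NumberField.discr K % 16 = 8)) := by
  constructor
  · intro h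
    have h3 := h 3 (by norm_num)
    have hnot : ¬ ¬ IsCyclic (restrict (K := K) (dvd_mul_left f (p ^ 3))).ker := not_not.2 h3
    rw [not_isCyclic_ker_restrict_dvd_prime_pow_mul_iff_of_prime h2 hp hf2 (le_refl 3)] at hnot
    exact not_or.1 hnot
  · rintro ⟨h3, h2'⟩ n hn
    by_cases hp2 : p = 2
    · subst hp2
      have h' : 4 ∣ f ∨ (2 ∣ f ∧ Even (NumberField.discr K)) ∨ (¬ 2 ∣ f ∧ NumberField.discr K % 16 = 8) := by
        by_contra hc
        exact h2' ⟨rfl, fun h4 => hc (Or.inl h4), fun he => hc (Or.inr (Or.inl he)),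
          fun ho => hc (Or.inr (Or.inr ho))⟩
      exact (forall_isCyclic_ker_restrict_dvd_two_pow_mul_iff_of_two_le h2 hf2).2 h' n hn
    · by_cases hpf : p ∣ f
      · exact isCyclic_ker_restrict_dvd_prime_pow_mul_of_prime_dvd h2 hp hp2 (by omega) hpf hn _
      · refine isCyclic_ker_restrict_dvd_prime_pow_mul_of_odd h2 hp hp2 hf2 hpf hn ?_ _
        rintro ⟨hp3, h9⟩
        subst hp3
        exact h3 ⟨rfl, hpf, h9⟩

end CMTypeLattice

end Literature.NumberTheory.ComplexMultiplication
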